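import Literature.Barriers.CriticalPhenomena.PositionSpaceRGNonGibbsianThm43Peierls
import Literature.Barriers.CriticalPhenomena.PositionSpaceRGNonGibbsianThm43Screening
import Literature.Barriers.CriticalPhenomena.PositionSpaceRGNonGibbsianThm43Reduction
import Literature.Barriers.CriticalPhenomena.PositionSpaceRGNonGibbsianUnfixing
import HarnessLib

/-!
# Barrier `PositionSpaceRGNonGibbsian`: Theorem 4.3 of van Enter–Fernández–Sokal holds
# (`VEFS1993_thm43_holds`)

Companion file of `Literature/Barriers/CriticalPhenomena/PositionSpaceRGNonGibbsian.lean` closing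
the Theorem 4.3 line (van Enter–Fernández–Sokal, J. Stat. Phys. **72** (1993) 879,
arXiv:hep-lat/9210032, Theorem 4.3, §4.3.1–§4.3.2 and App. B.5.3): for every dimension `d ≥ 2` and
every spacing `b ≥ 2` there is `J₀ < ∞` such that for all `J > J₀` the decimation `μT_b` of every
Gibbs measure `μ` of the zero-field Ising model is consistent with no quasilocal specification.

The source reduces Theorem 4.3 (§4.3.1 Steps 0–3, all proved in the tree:
`not_isQuasilocalMeasure_decimate_of_gapAt`, `gapAt_of_extremalGapAt`, the screening
`tendsto_isingExpect_local_plus_sub_minus'` and the unfixing identity `isingExpect_spinAt_eq_unfix`)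
to ONE low-temperature input, the phase transition of the internal-spin system with fully
alternating image spins (§4.3.2, "Step 1"), for which it invokes Pirogov–Sinai theory
(App. B.5.3). The tree replaces that input by the direct Peierls estimate
`isingExpect_neg_indicator_le` of `…Thm43Peierls.lean` (contour erasure by the exact symmetry
flip∘shift of the alternating system, valid for every `b ≥ 2`), and this file assembles:

* `isingExpect_exp_nbrSpinSum_ge` / `isingExpect_exp_neg_nbrSpinSum_le` — in the system
  `⟨R';R';p·ω'_alt;+;+⟩` on `Λ^int_{R'}` the two observables `e^{±2β∑_{y∼0}σ_y}` of (4.7)–(4.8) are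
  within `O(Q)` of their values `e^{±2β·2d}` at the all-`+` neighbourhood, `Q = Q(d,b,β) → 0`
  (Peierls bound on each `P(σ_u = -)`, `u ∼ 0`);
* `extremalGapAt_alternating` — the extremal gap (4.26)–(4.27) in the volume `W(R') = Λ^int_{R'} ∪ {0}`:
  unfix the origin ((4.7), `x = ⟨e^{-2β∑σ}⟩^{⟨R;R';+;+;-⟩}`, `x' = ⟨e^{+2β∑σ}⟩^{⟨R;R';-ω';+;-⟩}` by
  the spin flip (4.8)), move the `-` exterior to `+` by screening (Steps 2.1–2.2) and the `+`
  annulus down to the alternating pattern by FKG (Step 2.3), and conclude `x' - x ≥ e^{4dβ}/8`, whence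
  `⟨σ_0⟩^{±,+,-}_W - ⟨σ_0⟩^{±,-,+}_W ≥ δ(d,β) > 0` by (4.9) (`unfix_gap_bound`);
* `VEFS1993_thm43_holds : VEFS1993_thm43` — threshold `J₀(d,b)` explicit (Peierls smallness).

Everything is proved; no named fact is introduced (D-0014, D-0026).

## References

* A. C. D. van Enter, R. Fernández, A. D. Sokal, *Regularity properties and pathologies of
  position-space renormalization-group transformations: scope and limitations of Gibbsian theory*,
  J. Stat. Phys. 72 (1993) 879–1167, arXiv:hep-lat/9210032 — Theorem 4.3, §4.1.2 Step 3
  eqs. (4.7)–(4.13), §4.3.1 Steps 0–3 eqs. (4.25)–(4.32), §4.3.2, App. B.5.3 [VanenterFernandezSokal1993].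
* S. Friedli, Y. Velenik, *Statistical Mechanics of Lattice Systems*, CUP 2017, §3.6–3.7 (FKG,
  monotonicity in the boundary condition), §7.2 (thick contours) [FriedliVelenik2017].
* R. B. Griffiths, P. A. Pearce, J. Stat. Phys. 20 (1979) 499; R. B. Israel, Comm. Math. Phys. 82
  (1981) 305 (the model examples) [cited through VanenterFernandezSokal1993, §4.3].
-/

noncomputable section

namespace Literature.Barriers.CriticalPhenomena.NonGibbs

open MeasureTheory Finset Filter Topology Literature.Probability.LatticeModels

variable {d : ℕ}

/-! ### The volume `W(R') ∖ {0} = Λ^int_{R'}` and the neighbourhood of the origin -/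

/-- `W(R') ∖ {0} = Λ^int_{R'}`: unfixing the origin of `W(R')` leaves the internal-spin system in
`Λ^int_{R'}`. [cite: VanenterFernandezSokal1993, §4.1.2 Step 3 and §4.3.1 Step 3] -/
theorem spacingVolume_erase_zero (b R' : ℕ) :
    (spacingVolume d b R').erase 0 = spacingIntVolume d b R' := by
  ext x
  rw [Finset.mem_erase]
  constructor
  · rintro ⟨hx0, hxW⟩
    by_contra hxI
    exact hx0 (mem_spacingVolume_sdiff_iff.1 (Finset.mem_sdiff.2 ⟨hxW, hxI⟩))
  · intro hxI
    refine ⟨?_, spacingIntVolume_subset b R' hxI⟩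
    rintro rfl
    exact zero_notMem_spacingIntVolume b R' hxI

/-- The origin of `ℤ^d`, `d ≥ 1`, has a neighbour. [cite: FriedliVelenik2017, §3.1] -/
theorem card_neighborFinset_zero_pos (hd : 1 ≤ d) : 0 < ((zdGraph d).neighborFinset 0).card :=
  Finset.card_pos.2 ⟨_, (SimpleGraph.mem_neighborFinset _ _ _).2
    (by simpa using zdGraph_adj_add_single_one (0 : Site d) ⟨0, hd⟩)⟩

/-- `∑_{y∼0} σ_y` reads only core sites (the neighbours of the origin are field sites of the core,
`b ≥ 2`). [cite: VanenterFernandezSokal1993, §4.1.2 Step 3] -/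
theorem nbrSpinSum_zero_congr_spCoreSites {b : ℕ} (hb : 2 ≤ b) (R : ℕ) {σ σ' : SpinConfig (Site d)}
    (h : ∀ k ∈ spCoreSites d b R, σ k = σ' k) :
    nbrSpinSum (zdGraph d) 0 σ = nbrSpinSum (zdGraph d) 0 σ' := by
  unfold nbrSpinSum
  refine Finset.sum_congr rfl fun y hy => ?_
  rw [spinAt, spinAt, h y (mem_spCoreSites_of_adj_zero hb R ((SimpleGraph.mem_neighborFinset _ _ _).1 hy))]

/-- `|e^{c∑_{y∼0}σ_y}| ≤ e^{|c|·deg 0}`. [cite: VanenterFernandezSokal1993, §4.1.2 Step 3] -/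
theorem abs_exp_mul_nbrSpinSum_le (c : ℝ) (σ : SpinConfig (Site d)) :
    |Real.exp (c * nbrSpinSum (zdGraph d) 0 σ)| ≤
      Real.exp (|c| * ((zdGraph d).neighborFinset 0).card) := by
  rw [abs_of_pos (Real.exp_pos _)]
  refine Real.exp_le_exp.2 ?_
  calc c * nbrSpinSum (zdGraph d) 0 σ ≤ |c * nbrSpinSum (zdGraph d) 0 σ| := le_abs_self _
    _ = |c| * |nbrSpinSum (zdGraph d) 0 σ| := abs_mul _ _
    _ ≤ |c| * ((zdGraph d).neighborFinset 0).card :=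
        mul_le_mul_of_nonneg_left (abs_nbrSpinSum_le (zdGraph d) 0 σ) (abs_nonneg c)

/-! ### The number of `-` neighbours of the origin -/

/-- `∑_{y∼0} σ_y = deg 0 - 2 D(σ)` with `D(σ) = ∑_{u∼0} (1-σ_u)/2` the number of `-` neighbours.
[cite: VanenterFernandezSokal1993, §4.1.2 Step 3] -/
theorem nbrSpinSum_zero_eq_card_sub (σ : SpinConfig (Site d)) :
    nbrSpinSum (zdGraph d) 0 σ = ((zdGraph d).neighborFinset 0).card -
      2 * ∑ u ∈ (zdGraph d).neighborFinset 0, (1 - spinAt u σ) / 2 := by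
  unfold nbrSpinSum
  rw [← Finset.sum_div, Finset.sum_sub_distrib, Finset.sum_const, nsmul_eq_mul, mul_one]
  ring

/-- Each term `(1-σ_u)/2` is `0` or `1`, hence nonnegative. [folklore] -/
theorem one_sub_spinAt_div_two_nonneg (u : Site d) (σ : SpinConfig (Site d)) :
    0 ≤ (1 - spinAt u σ) / 2 := by
  rcases spinAt_eq_one_or_eq_neg_one u σ with h | h <;> rw [h] <;> norm_num

/-- `D(σ) = 0` (all neighbours `+`) or `D(σ) ≥ 1`. [folklore] -/
theorem sum_one_sub_spinAt_eq_zero_or_one_le (σ : SpinConfig (Site d)) :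
    ∑ u ∈ (zdGraph d).neighborFinset 0, (1 - spinAt u σ) / 2 = 0 ∨
      1 ≤ ∑ u ∈ (zdGraph d).neighborFinset 0, (1 - spinAt u σ) / 2 := by
  by_cases h : ∃ u ∈ (zdGraph d).neighborFinset 0, spinAt u σ ≠ 1
  swap
  · exact Or.inl (Finset.sum_eq_zero fun u hu => by
      rw [show spinAt u σ = 1 from not_not.1 fun hne => h ⟨u, hu, hne⟩]; norm_num)
  · obtain ⟨u, hu, hne⟩ := h
    have hu1 : spinAt u σ = -1 := (spinAt_eq_one_or_eq_neg_one u σ).resolve_left hne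
    refine Or.inr ?_
    calc (1 : ℝ) = (1 - spinAt u σ) / 2 := by rw [hu1]; norm_num
      _ ≤ ∑ u ∈ (zdGraph d).neighborFinset 0, (1 - spinAt u σ) / 2 :=
          Finset.single_le_sum (fun v _ => one_sub_spinAt_div_two_nonneg v σ) hu

/-- **Pointwise lower bound for `e^{+2β∑σ}`**: `e^{2β deg 0}(1 - D(σ)) ≤ e^{2β∑_{y∼0}σ_y}` (`β ≥ 0`;
equality when all neighbours are `+`, trivial otherwise).
[cite: VanenterFernandezSokal1993, §4.1.2 Step 3 eq. (4.12)] -/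
theorem exp_mul_card_mul_one_sub_le (β : ℝ) (σ : SpinConfig (Site d)) :
    Real.exp (2 * β * ((zdGraph d).neighborFinset 0).card) *
        (1 - ∑ u ∈ (zdGraph d).neighborFinset 0, (1 - spinAt u σ) / 2) ≤
      Real.exp (2 * β * nbrSpinSum (zdGraph d) 0 σ) := by
  rcases sum_one_sub_spinAt_eq_zero_or_one_le σ with h0 | h1
  · rw [nbrSpinSum_zero_eq_card_sub, h0]
    simp
  · calc Real.exp (2 * β * ((zdGraph d).neighborFinset 0).card) *
          (1 - ∑ u ∈ (zdGraph d).neighborFinset 0, (1 - spinAt u σ) / 2) ≤ 0 :=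
          mul_nonpos_of_nonneg_of_nonpos (Real.exp_nonneg _) (by linarith)
      _ ≤ _ := Real.exp_nonneg _

/-- **Pointwise upper bound for `e^{-2β∑σ}`**: `e^{-2β∑_{y∼0}σ_y} ≤ e^{-2β deg 0} + e^{2β deg 0} D(σ)`
(`β ≥ 0`). [cite: VanenterFernandezSokal1993, §4.1.2 Step 3 eq. (4.12)] -/
theorem exp_neg_mul_nbrSpinSum_le {β : ℝ} (hβ : 0 ≤ β) (σ : SpinConfig (Site d)) :
    Real.exp (-(2 * β * nbrSpinSum (zdGraph d) 0 σ)) ≤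
      Real.exp (-(2 * β * ((zdGraph d).neighborFinset 0).card)) +
        Real.exp (2 * β * ((zdGraph d).neighborFinset 0).card) *
          ∑ u ∈ (zdGraph d).neighborFinset 0, (1 - spinAt u σ) / 2 := by
  rcases sum_one_sub_spinAt_eq_zero_or_one_le σ with h0 | h1
  · rw [nbrSpinSum_zero_eq_card_sub, h0]
    simp
  · have hS : -(2 * β * nbrSpinSum (zdGraph d) 0 σ) ≤ 2 * β * ((zdGraph d).neighborFinset 0).card := by
      have h1 := abs_nbrSpinSum_le (zdGraph d) 0 σ
      have h2 : -nbrSpinSum (zdGraph d) 0 σ ≤ ((zdGraph d).neighborFinset 0).card := by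
        linarith [neg_abs_le (nbrSpinSum (zdGraph d) 0 σ)]
      nlinarith
    calc Real.exp (-(2 * β * nbrSpinSum (zdGraph d) 0 σ))
        ≤ Real.exp (2 * β * ((zdGraph d).neighborFinset 0).card) := Real.exp_le_exp.2 hS
      _ ≤ Real.exp (2 * β * ((zdGraph d).neighborFinset 0).card) *
            ∑ u ∈ (zdGraph d).neighborFinset 0, (1 - spinAt u σ) / 2 :=
          le_mul_of_one_le_right (Real.exp_nonneg _) h1
      _ ≤ _ := le_add_of_nonneg_left (Real.exp_nonneg _)

/-! ### Expectations: linearity and the Peierls input -/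

/-- Measurability of `(1-σ_u)/2`. [folklore] -/
theorem measurable_one_sub_spinAt_div_two (u : Site d) :
    Measurable fun σ : SpinConfig (Site d) => (1 - spinAt u σ) / 2 :=
  (measurable_const.sub (measurable_spinAt u)).div_const 2

/-- `⟨a + c D⟩ = a + c ∑_{u∼0} ⟨(1-σ_u)/2⟩` (linearity of the finite-volume expectation). [folklore] -/
theorem isingExpect_const_add_mul_sum (Λ : Finset (Site d)) (β : ℝ) (bc : BoundaryCondition (Site d))
    (a c : ℝ) :
    isingExpect (zdGraph d) Λ β 0 bc
        (fun σ => a + c * ∑ u ∈ (zdGraph d).neighborFinset 0, (1 - spinAt u σ) / 2) =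
      a + c * ∑ u ∈ (zdGraph d).neighborFinset 0,
        isingExpect (zdGraph d) Λ β 0 bc (fun σ => (1 - spinAt u σ) / 2) := by
  have hmD : Measurable fun σ : SpinConfig (Site d) =>
      ∑ u ∈ (zdGraph d).neighborFinset 0, (1 - spinAt u σ) / 2 :=
    Finset.measurable_sum _ fun u _ => measurable_one_sub_spinAt_div_two u
  rw [isingExpect_add' (zdGraph d) Λ 0 bc β (f := fun _ => a) measurable_const (hmD.const_mul c),
    isingExpect_const, isingExpect_const_mul' (zdGraph d) Λ 0 bc β c hmD,
    isingExpect_finset_sum' (zdGraph d) Λ 0 bc β _ (fun u σ => (1 - spinAt u σ) / 2)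
      measurable_one_sub_spinAt_div_two]

/-- **Lower bound for `⟨e^{+2β∑σ}⟩`** in any finite-volume system:
`⟨e^{2β∑_{y∼0}σ_y}⟩ ≥ e^{2β deg 0}(1 - ∑_{u∼0} ⟨(1-σ_u)/2⟩)`.
[cite: VanenterFernandezSokal1993, §4.1.2 Step 3 eq. (4.12)] -/
theorem isingExpect_exp_nbrSpinSum_ge (Λ : Finset (Site d)) (β : ℝ) (bc : BoundaryCondition (Site d)) :
    Real.exp (2 * β * ((zdGraph d).neighborFinset 0).card) *
        (1 - ∑ u ∈ (zdGraph d).neighborFinset 0,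
          isingExpect (zdGraph d) Λ β 0 bc (fun σ => (1 - spinAt u σ) / 2)) ≤
      isingExpect (zdGraph d) Λ β 0 bc (fun σ => Real.exp (2 * β * nbrSpinSum (zdGraph d) 0 σ)) := by
  set C := Real.exp (2 * β * ((zdGraph d).neighborFinset 0).card) with hC
  have h := isingExpect_const_add_mul_sum (d := d) Λ β bc C (-C)
  have hfun : (fun σ : SpinConfig (Site d) =>
      C + -C * ∑ u ∈ (zdGraph d).neighborFinset 0, (1 - spinAt u σ) / 2) =
      fun σ => C * (1 - ∑ u ∈ (zdGraph d).neighborFinset 0, (1 - spinAt u σ) / 2) := by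
    funext σ; ring
  rw [hfun] at h
  have hle := isingExpect_mono_fun (zdGraph d) Λ β 0 bc
    (f := fun σ => C * (1 - ∑ u ∈ (zdGraph d).neighborFinset 0, (1 - spinAt u σ) / 2))
    (g := fun σ => Real.exp (2 * β * nbrSpinSum (zdGraph d) 0 σ))
    ((Finset.measurable_sum _ fun u _ => measurable_one_sub_spinAt_div_two u).const_sub 1
      |>.const_mul C)
    (Real.measurable_exp.comp ((measurable_nbrSpinSum (zdGraph d) 0).const_mul (2 * β)))
    (exp_mul_card_mul_one_sub_le (d := d) β)
  rw [h] at hle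
  linarith

/-- **Upper bound for `⟨e^{-2β∑σ}⟩`** in any finite-volume system (`β ≥ 0`):
`⟨e^{-2β∑_{y∼0}σ_y}⟩ ≤ e^{-2β deg 0} + e^{2β deg 0} ∑_{u∼0} ⟨(1-σ_u)/2⟩`.
[cite: VanenterFernandezSokal1993, §4.1.2 Step 3 eq. (4.12)] -/
theorem isingExpect_exp_neg_nbrSpinSum_le (Λ : Finset (Site d)) {β : ℝ} (hβ : 0 ≤ β)
    (bc : BoundaryCondition (Site d)) :
    isingExpect (zdGraph d) Λ β 0 bc (fun σ => Real.exp (-(2 * β * nbrSpinSum (zdGraph d) 0 σ))) ≤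
      Real.exp (-(2 * β * ((zdGraph d).neighborFinset 0).card)) +
        Real.exp (2 * β * ((zdGraph d).neighborFinset 0).card) *
          ∑ u ∈ (zdGraph d).neighborFinset 0,
            isingExpect (zdGraph d) Λ β 0 bc (fun σ => (1 - spinAt u σ) / 2) := by
  have h := isingExpect_const_add_mul_sum (d := d) Λ β bc
    (Real.exp (-(2 * β * ((zdGraph d).neighborFinset 0).card)))
    (Real.exp (2 * β * ((zdGraph d).neighborFinset 0).card))
  have hle := isingExpect_mono_fun (zdGraph d) Λ β 0 bc
    (f := fun σ => Real.exp (-(2 * β * nbrSpinSum (zdGraph d) 0 σ)))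
    (g := fun σ => Real.exp (-(2 * β * ((zdGraph d).neighborFinset 0).card)) +
        Real.exp (2 * β * ((zdGraph d).neighborFinset 0).card) *
          ∑ u ∈ (zdGraph d).neighborFinset 0, (1 - spinAt u σ) / 2)
    (Real.measurable_exp.comp ((measurable_nbrSpinSum (zdGraph d) 0).const_mul (2 * β)).neg)
    (((Finset.measurable_sum _ fun u _ => measurable_one_sub_spinAt_div_two u).const_mul _).const_add _)
    (exp_neg_mul_nbrSpinSum_le (d := d) hβ)
  rw [h] at hle
  exact hle

/-- **The Peierls input, summed over the neighbours of the origin**: in the system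
`⟨R';R';p·ω'_alt;+;+⟩` on `Λ^int_{R'}` (all image spins of `Λ_{R'}` alternating with parity `p`,
`+` internal boundary condition), `∑_{u∼0} P(σ_u = -) ≤ deg 0 · 2Q` at low temperature
(`isingExpect_neg_indicator_le`; the neighbours of the origin are internal sites).
[cite: VanenterFernandezSokal1993, §4.3.2 and App. B.5.3] -/
theorem sum_isingExpect_neg_indicator_le (hd : 2 ≤ d) {b : ℕ} (hb : 2 ≤ b) {β : ℝ} (hβ : 0 ≤ β)
    (hsmall : (27 : ℝ) ^ d * ((2 : ℝ) ^ (2 * (b + 1) + 3) ^ d *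
      Real.exp (-(β / (2 * ((b : ℝ) + 1) + 1) ^ d))) ≤ 1 / 2)
    (p : ℤˣ) (R' : ℕ) :
    ∑ u ∈ (zdGraph d).neighborFinset 0,
        isingExpect (zdGraph d) (spacingIntVolume d b R') β 0
          (.fixed (signedCoreAnnulusBC d b p R' R' 1 1)) (fun σ => (1 - spinAt u σ) / 2) ≤
      ((zdGraph d).neighborFinset 0).card *
        (2 * ((2 : ℝ) ^ (2 * (b + 1) + 3) ^ d * Real.exp (-(β / (2 * ((b : ℝ) + 1) + 1) ^ d)))) := by
  calc ∑ u ∈ (zdGraph d).neighborFinset 0,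
        isingExpect (zdGraph d) (spacingIntVolume d b R') β 0
          (.fixed (signedCoreAnnulusBC d b p R' R' 1 1)) (fun σ => (1 - spinAt u σ) / 2)
      ≤ ∑ _u ∈ (zdGraph d).neighborFinset 0,
          2 * ((2 : ℝ) ^ (2 * (b + 1) + 3) ^ d * Real.exp (-(β / (2 * ((b : ℝ) + 1) + 1) ^ d))) :=
        Finset.sum_le_sum fun u hu => isingExpect_neg_indicator_le hd hb hβ hsmall p R'
          (not_isSpImageSite_of_adj_zero hb ((SimpleGraph.mem_neighborFinset _ _ _).1 hu))
    _ = _ := by rw [Finset.sum_const, nsmul_eq_mul]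

/-! ### The extremal gap (4.26)–(4.27) in `W(R')` -/

/-- **The extremal gap of §4.3.1 at `(d, b, β, R)`, from the Peierls estimate.** For `d ≥ 2`,
`b ≥ 2`, `β ≥ 2` in the Peierls regime (`27^d Q ≤ ½`, `8 deg 0 · Q ≤ 1`) and every `R` there is
`R' > R` with
`⟨σ_0⟩^{⟨R;R';ω';+;-⟩}_{W(R')} - ⟨σ_0⟩^{⟨R;R';ω';-;+⟩}_{W(R')} ≥ δ := 2(B/8)/(1+B)²`, `B = e^{2β deg 0}`.
Proof (§4.1.2 Step 3 with §4.3.1 Step 2): unfix the origin, `⟨σ_0⟩^{ζ} = (1-x_ζ)/(1+x_ζ)` with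
`x_ζ = ⟨e^{-2β∑_{y∼0}σ_y}⟩^{ζ}_{Λ^int_{R'}}` ((4.7), `isingExpect_spinAt_eq_unfix`); for `ζ₋ = ⟨R;R';ω';-;+⟩`,
`x_{ζ₋} = ⟨e^{+2β∑σ}⟩^{-ζ₋}` by the spin flip (4.8) and `-ζ₋ = ⟨R;R';-ω';+;-⟩` (`neg_coreAnnulusBC`);
screening moves the `-` exterior of both systems to `+` at cost `ε = B/8` for `R'` large
(`tendsto_isingExpect_local_plus_sub_minus'`), FKG lowers the `+` annulus to the alternating pattern
(`isingExpect_fixed_mono`, `signedCoreAnnulusBC_anti_core`; `e^{+2β∑σ}` nondecreasing, `e^{-2β∑σ}`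
nonincreasing), and in the fully alternating systems the Peierls estimate gives
`⟨e^{+2β∑σ}⟩ ≥ B(1 - 2 deg0 Q)`, `⟨e^{-2β∑σ}⟩ ≤ B⁻¹ + 2 deg0 Q B`; so `x' - x ≥ B/8` and (4.9)
(`unfix_gap_bound`) gives the gap. [cite: VanenterFernandezSokal1993, §4.1.2 Step 3 eqs. (4.7)–(4.13), §4.3.1 Step 2 eqs. (4.26)–(4.27), §4.3.2] -/
theorem extremalGapAt_alternating (hd : 2 ≤ d) {b : ℕ} (hb : 2 ≤ b) {β : ℝ} (hβ2 : 2 ≤ β)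
    (hsmall : (27 : ℝ) ^ d * ((2 : ℝ) ^ (2 * (b + 1) + 3) ^ d *
      Real.exp (-(β / (2 * ((b : ℝ) + 1) + 1) ^ d))) ≤ 1 / 2)
    (hsmall' : 8 * ((zdGraph d).neighborFinset 0).card *
      ((2 : ℝ) ^ (2 * (b + 1) + 3) ^ d * Real.exp (-(β / (2 * ((b : ℝ) + 1) + 1) ^ d))) ≤ 1)
    (R : ℕ) :
    ∃ R' : ℕ, R < R' ∧
      2 * (Real.exp (2 * β * ((zdGraph d).neighborFinset 0).card) / 8) /
          (1 + Real.exp (2 * β * ((zdGraph d).neighborFinset 0).card)) ^ 2 ≤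
        isingExpect (zdGraph d) (spacingVolume d b R') β 0
            (.fixed (coreAnnulusBC d b R R' 1 (-1))) (spinAt 0) -
          isingExpect (zdGraph d) (spacingVolume d b R') β 0
            (.fixed (coreAnnulusBC d b R R' (-1) 1)) (spinAt 0) := by
  have hb0 : 0 < b := by omega
  have hβ : 0 ≤ β := by linarith
  have hβpos : 0 < β := by linarith
  set N := (zdGraph d).neighborFinset 0 with hN
  set n₀ : ℝ := (N.card : ℝ) with hn₀
  set B : ℝ := Real.exp (2 * β * n₀) with hB
  set Q : ℝ := (2 : ℝ) ^ (2 * (b + 1) + 3) ^ d * Real.exp (-(β / (2 * ((b : ℝ) + 1) + 1) ^ d)) with hQ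
  have hB0 : 0 < B := Real.exp_pos _
  have hQ0 : 0 ≤ Q := by positivity
  have hn₀1 : 1 ≤ n₀ := by
    rw [hn₀]; exact_mod_cast card_neighborFinset_zero_pos (d := d) (by omega)
  -- the two observables
  set g : SpinConfig (Site d) → ℝ := fun σ => Real.exp (-(2 * β * nbrSpinSum (zdGraph d) 0 σ)) with hg
  set gt : SpinConfig (Site d) → ℝ := fun σ => Real.exp (2 * β * nbrSpinSum (zdGraph d) 0 σ) with hgt
  have hg_meas : Measurable g :=
    Real.measurable_exp.comp ((measurable_nbrSpinSum (zdGraph d) 0).const_mul (2 * β)).neg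
  have hgt_meas : Measurable gt :=
    Real.measurable_exp.comp ((measurable_nbrSpinSum (zdGraph d) 0).const_mul (2 * β))
  have hgt_mono : Monotone gt := fun σ₁ σ₂ h =>
    Real.exp_le_exp.2 (mul_le_mul_of_nonneg_left (nbrSpinSum_mono (zdGraph d) 0 h) (by positivity))
  have hng_mono : Monotone fun σ => (-1 : ℝ) * g σ := fun σ₁ σ₂ h => by
    simp only [neg_one_mul, neg_le_neg_iff, hg]
    exact Real.exp_le_exp.2 (neg_le_neg (mul_le_mul_of_nonneg_left (nbrSpinSum_mono (zdGraph d) 0 h)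
      (by positivity)))
  have hg_bd : ∀ σ, |g σ| ≤ B := fun σ => by
    have := abs_exp_mul_nbrSpinSum_le (d := d) (-(2 * β)) σ
    rw [abs_neg, abs_of_nonneg (by positivity : (0 : ℝ) ≤ 2 * β)] at this
    simpa only [hg, neg_mul] using this
  have hgt_bd : ∀ σ, |gt σ| ≤ B := fun σ => by
    have := abs_exp_mul_nbrSpinSum_le (d := d) (2 * β) σ
    rwa [abs_of_nonneg (by positivity : (0 : ℝ) ≤ 2 * β)] at this
  have hg_loc : ∀ σ σ' : SpinConfig (Site d), (∀ k ∈ spCoreSites d b R, σ k = σ' k) → g σ = g σ' :=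
    fun σ σ' h => by simp only [hg, nbrSpinSum_zero_congr_spCoreSites hb R h]
  have hgt_loc : ∀ σ σ' : SpinConfig (Site d), (∀ k ∈ spCoreSites d b R, σ k = σ' k) → gt σ = gt σ' :=
    fun σ σ' h => by simp only [hgt, nbrSpinSum_zero_congr_spCoreSites hb R h]
  -- screening thresholds at `ε = B/8`
  have hε : 0 < B / 8 := by positivity
  obtain ⟨R₁, hR₁⟩ := Metric.tendsto_atTop.1
    (tendsto_isingExpect_local_plus_sub_minus' (d := d) hb hβpos 1 R hg_meas hg_loc hg_bd) (B / 8) hε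
  obtain ⟨R₂, hR₂⟩ := Metric.tendsto_atTop.1
    (tendsto_isingExpect_local_plus_sub_minus' (d := d) hb hβpos (-1) R hgt_meas hgt_loc hgt_bd) (B / 8) hε
  set R' : ℕ := max (max R₁ R₂) (R + 1) with hR'def
  have hRR' : R < R' := by omega
  have h₁ : R₁ ≤ R' := by omega
  have h₂ : R₂ ≤ R' := by omega
  have hR'1 : 1 ≤ R' := by omega
  refine ⟨R', hRR', ?_⟩
  set Λ := spacingIntVolume d b R' with hΛ
  -- unfixing the origin in both systems
  have hN0 : ∀ y, (zdGraph d).Adj 0 y → y ∈ (spacingVolume d b R').erase 0 := fun y hy => by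
    rw [spacingVolume_erase_zero]; exact mem_spacingIntVolume_of_adj_zero hb hR'1 hy
  have hζp : coreAnnulusBC d b R R' 1 (-1) 0 = 1 := by
    have := signedCoreAnnulusBC_zero (d := d) hb0 1 R R' 1 (-1)
    rwa [signedCoreAnnulusBC_one] at this
  have hζm : coreAnnulusBC d b R R' (-1) 1 0 = 1 := by
    have := signedCoreAnnulusBC_zero (d := d) hb0 1 R R' (-1) 1
    rwa [signedCoreAnnulusBC_one] at this
  rw [isingExpect_spinAt_eq_unfix (zdGraph d) (zero_mem_spacingVolume b R') hN0 β hζp,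
    isingExpect_spinAt_eq_unfix (zdGraph d) (zero_mem_spacingVolume b R') hN0 β hζm,
    spacingVolume_erase_zero]
  -- the two unfixed expectations `x`, `x'`
  set x := isingExpect (zdGraph d) Λ β 0 (.fixed (coreAnnulusBC d b R R' 1 (-1))) g with hx
  set x' := isingExpect (zdGraph d) Λ β 0 (.fixed (coreAnnulusBC d b R R' (-1) 1)) g with hx'
  change 2 * (B / 8) / (1 + B) ^ 2 ≤ (1 - x) / (1 + x) - (1 - x') / (1 + x')
  have hx0 : 0 < x := isingExpect_pos (zdGraph d) Λ β 0 _ hg_meas (fun σ => Real.exp_pos _)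
  have hx'0 : 0 < x' := isingExpect_pos (zdGraph d) Λ β 0 _ hg_meas (fun σ => Real.exp_pos _)
  have hxB : x ≤ B := (le_abs_self _).trans ((Real.norm_eq_abs _).symm.le.trans
    (norm_isingExpect_le (zdGraph d) Λ β 0 _ (fun σ => (Real.norm_eq_abs _).le.trans (hg_bd σ))))
  have hx'B : x' ≤ B := (le_abs_self _).trans ((Real.norm_eq_abs _).symm.le.trans
    (norm_isingExpect_le (zdGraph d) Λ β 0 _ (fun σ => (Real.norm_eq_abs _).le.trans (hg_bd σ))))
  -- (4.8): `x'` is the `e^{+2β∑σ}` expectation of the flipped system `⟨R;R';-ω';+;-⟩`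
  have hx'flip : x' = isingExpect (zdGraph d) Λ β 0
      (.fixed (signedCoreAnnulusBC d b (-1) R R' 1 (-1))) gt := by
    have hneg : coreAnnulusBC d b R R' (-1) 1 = -signedCoreAnnulusBC d b (-1) R R' 1 (-1) := by
      have := neg_coreAnnulusBC (d := d) b R R' (-1) 1
      rw [neg_neg] at this
      rw [← this, neg_neg]
    have hf := isingExpect_fixed_neg (zdGraph d) Λ β 0 (signedCoreAnnulusBC d b (-1) R R' 1 (-1)) hg_meas
    rw [neg_zero] at hf
    rw [hx', hneg, hf]
    refine congrArg _ (funext fun σ => ?_)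
    simp only [hg, hgt, nbrSpinSum_neg, mul_neg, neg_neg]
  -- upper bound for `x`: screening (`-` exterior → `+` exterior), FKG (annulus down), Peierls
  have hx_le : x ≤ 1 / B + B * (n₀ * (2 * Q)) + B / 8 := by
    -- screening at parity `1`
    have hs := hR₁ R' h₁
    rw [Real.dist_eq, sub_zero, abs_lt] at hs
    have hs' : isingExpect (zdGraph d) Λ β 0 (.fixed (signedCoreAnnulusBC d b 1 R R' 1 (-1))) g <
        isingExpect (zdGraph d) Λ β 0 (.fixed (signedCoreAnnulusBC d b 1 R R' 1 1)) g + B / 8 := by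
      linarith [hs.1]
    have hxs : x = isingExpect (zdGraph d) Λ β 0 (.fixed (signedCoreAnnulusBC d b 1 R R' 1 (-1))) g := by
      rw [hx, signedCoreAnnulusBC_one]
    -- FKG: `g` nonincreasing, annulus `+ ≥ ω'`
    have hfkg : isingExpect (zdGraph d) Λ β 0 (.fixed (signedCoreAnnulusBC d b 1 R R' 1 1)) g ≤
        isingExpect (zdGraph d) Λ β 0 (.fixed (signedCoreAnnulusBC d b 1 R' R' 1 1)) g := by
      have h := isingExpect_fixed_mono (zdGraph d) hβ Λ 0
        (signedCoreAnnulusBC_anti_core (d := d) (b := b) 1 hRR'.le 1) hng_mono (hg_meas.const_mul (-1))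
      rw [isingExpect_const_mul' (zdGraph d) Λ 0 _ β (-1) hg_meas,
        isingExpect_const_mul' (zdGraph d) Λ 0 _ β (-1) hg_meas] at h
      linarith
    -- Peierls in the fully alternating system of parity `1`
    have hP := isingExpect_exp_neg_nbrSpinSum_le (d := d) Λ hβ (.fixed (signedCoreAnnulusBC d b 1 R' R' 1 1))
    have hsum := sum_isingExpect_neg_indicator_le hd hb hβ hsmall 1 R'
    have hB' : Real.exp (-(2 * β * n₀)) = 1 / B := by rw [hB, Real.exp_neg, one_div]
    have hmul : Real.exp (2 * β * n₀) * ∑ u ∈ N, isingExpect (zdGraph d) Λ β 0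
        (.fixed (signedCoreAnnulusBC d b 1 R' R' 1 1)) (fun σ => (1 - spinAt u σ) / 2) ≤ B * (n₀ * (2 * Q)) :=
      mul_le_mul_of_nonneg_left hsum hB0.le
    have : isingExpect (zdGraph d) Λ β 0 (.fixed (signedCoreAnnulusBC d b 1 R' R' 1 1)) g ≤
        1 / B + B * (n₀ * (2 * Q)) := by
      rw [← hB']; exact hP.trans (by linarith)
    linarith
  -- lower bound for `x'`: screening at parity `-1`, FKG (annulus down, `gt` nondecreasing), Peierls
  have hx'_ge : B * (1 - n₀ * (2 * Q)) - B / 8 ≤ x' := by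
    have hs := hR₂ R' h₂
    rw [Real.dist_eq, sub_zero, abs_lt] at hs
    have hs' : isingExpect (zdGraph d) Λ β 0 (.fixed (signedCoreAnnulusBC d b (-1) R R' 1 1)) gt - B / 8 <
        isingExpect (zdGraph d) Λ β 0 (.fixed (signedCoreAnnulusBC d b (-1) R R' 1 (-1))) gt := by
      linarith [hs.2]
    have hfkg : isingExpect (zdGraph d) Λ β 0 (.fixed (signedCoreAnnulusBC d b (-1) R' R' 1 1)) gt ≤
        isingExpect (zdGraph d) Λ β 0 (.fixed (signedCoreAnnulusBC d b (-1) R R' 1 1)) gt :=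
      isingExpect_fixed_mono (zdGraph d) hβ Λ 0
        (signedCoreAnnulusBC_anti_core (d := d) (b := b) (-1) hRR'.le 1) hgt_mono hgt_meas
    have hP := isingExpect_exp_nbrSpinSum_ge (d := d) Λ β (.fixed (signedCoreAnnulusBC d b (-1) R' R' 1 1))
    have hsum := sum_isingExpect_neg_indicator_le hd hb hβ hsmall (-1) R'
    have hmul : B * (1 - n₀ * (2 * Q)) ≤ Real.exp (2 * β * n₀) * (1 - ∑ u ∈ N, isingExpect (zdGraph d) Λ β 0
        (.fixed (signedCoreAnnulusBC d b (-1) R' R' 1 1)) (fun σ => (1 - spinAt u σ) / 2)) :=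
      mul_le_mul_of_nonneg_left (by linarith) hB0.le
    rw [hx'flip]
    linarith
  -- the arithmetic of (4.12): `x' - x ≥ B/8`
  have hB8 : 8 ≤ B * B := by
    have h1 : B * B = Real.exp (4 * β * n₀) := by rw [hB, ← Real.exp_add]; ring_nf
    rw [h1]
    have h2 : 4 * β * n₀ + 1 ≤ Real.exp (4 * β * n₀) := Real.add_one_le_exp _
    nlinarith
  have hinvB : 1 / B ≤ B / 8 := by
    rw [div_le_div_iff₀ hB0 (by norm_num : (0 : ℝ) < 8)]
    nlinarith
  have hnQ : n₀ * (2 * Q) ≤ 1 / 4 := by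
    have : 8 * n₀ * Q ≤ 1 := hsmall'
    linarith
  have hgap : B / 8 ≤ x' - x := by nlinarith
  exact unfix_gap_bound hx0 hxB hx'0 hx'B (by positivity) hgap

/-! ### The threshold and Theorem 4.3 -/

/-- **An explicit low-temperature threshold** making the Peierls smallness conditions of
`extremalGapAt_alternating` hold: `J₀ = max(2, A K (2·27^d + 8 deg 0))` with `A = 2^{(2b+5)^d}`,
`K = (2b+3)^d` (then `Q = A e^{-β/K} < A K/β`). [cite: VanenterFernandezSokal1993, Theorem 4.3 ("Then there exists a `J₀ < ∞` (depending on `d` and `b`)")] -/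
theorem exists_threshold_peierls (d b : ℕ) :
    ∃ J₀ : ℝ, ∀ β : ℝ, J₀ < β → 2 ≤ β ∧
      (27 : ℝ) ^ d * ((2 : ℝ) ^ (2 * (b + 1) + 3) ^ d *
        Real.exp (-(β / (2 * ((b : ℝ) + 1) + 1) ^ d))) ≤ 1 / 2 ∧
      8 * ((zdGraph d).neighborFinset 0).card *
        ((2 : ℝ) ^ (2 * (b + 1) + 3) ^ d * Real.exp (-(β / (2 * ((b : ℝ) + 1) + 1) ^ d))) ≤ 1 := by
  set A : ℝ := (2 : ℝ) ^ (2 * (b + 1) + 3) ^ d with hA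
  set K : ℝ := (2 * ((b : ℝ) + 1) + 1) ^ d with hK
  set n₀ : ℝ := (((zdGraph d).neighborFinset 0).card : ℝ) with hn₀
  have hA1 : 1 ≤ A := one_le_pow₀ (by norm_num)
  have hK0 : 0 < K := by positivity
  have hn₀0 : 0 ≤ n₀ := by positivity
  refine ⟨max 2 (A * K * (2 * 27 ^ d + 8 * n₀)), fun β hβ => ?_⟩
  have hβ2 : 2 ≤ β := le_of_lt (lt_of_le_of_lt (le_max_left _ _) hβ)
  have hβC : A * K * (2 * 27 ^ d + 8 * n₀) < β := lt_of_le_of_lt (le_max_right _ _) hβ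
  have hβ0 : 0 < β := by linarith
  -- `e^{-β/K} < K/β`
  have hexp : Real.exp (-(β / K)) < K / β := by
    have h1 : β / K + 1 ≤ Real.exp (β / K) := Real.add_one_le_exp _
    have h2 : 0 < β / K := div_pos hβ0 hK0
    rw [Real.exp_neg, inv_eq_one_div, div_lt_div_iff₀ (Real.exp_pos _) hβ0]
    calc 1 * β = K * (β / K) := by field_simp
      _ < K * Real.exp (β / K) := mul_lt_mul_of_pos_left (by linarith) hK0
  have hQ : A * Real.exp (-(β / K)) ≤ A * (K / β) := mul_le_mul_of_nonneg_left hexp.le (by positivity)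
  have h27 : (0 : ℝ) < 27 ^ d := by positivity
  refine ⟨hβ2, ?_, ?_⟩
  · -- `27^d A K/β ≤ 1/2`
    have h1 : (27 : ℝ) ^ d * (A * (K / β)) ≤ 1 / 2 := by
      rw [show (27 : ℝ) ^ d * (A * (K / β)) = (27 ^ d * A * K) / β by ring,
        div_le_div_iff₀ hβ0 (by norm_num : (0 : ℝ) < 2)]
      nlinarith [mul_nonneg (mul_nonneg (le_trans zero_le_one hA1) hK0.le) hn₀0]
    exact (mul_le_mul_of_nonneg_left hQ h27.le).trans h1
  · have h1 : 8 * n₀ * (A * (K / β)) ≤ 1 := by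
      rw [show 8 * n₀ * (A * (K / β)) = (8 * n₀ * A * K) / β by ring, div_le_one hβ0]
      nlinarith [mul_nonneg (le_trans zero_le_one hA1) hK0.le, h27]
    exact (mul_le_mul_of_nonneg_left hQ (by positivity)).trans h1

/-- **Theorem 4.3 of van Enter–Fernández–Sokal holds** (`d ≥ 2`, every spacing `b ≥ 2`): for
`J > J₀(d, b)` the decimation `μT_b` of every Gibbs measure of the zero-field Ising model is
consistent with no quasilocal specification. Assembly as printed (§4.3.1 Steps 0–3 of the tree,
`not_isQuasilocalMeasure_decimate_of_gapAt` and `gapAt_of_extremalGapAt`) with the extremal gap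
`extremalGapAt_alternating` supplied by the Peierls estimate of `…Thm43Peierls.lean` in place of the
Pirogov–Sinai input of §4.3.2 / App. B.5.3. [cite: VanenterFernandezSokal1993, Theorem 4.3] -/
theorem VEFS1993_thm43_holds : VEFS1993_thm43 := by
  intro d b hd hb
  obtain ⟨J₀, hJ₀⟩ := exists_threshold_peierls d b
  refine ⟨J₀, fun β hβ μ hμ => ?_⟩
  obtain ⟨hβ2, hC1, hC2⟩ := hJ₀ β hβ
  have hb0 : 0 < b := by omega
  have hβ0 : 0 ≤ β := by linarith
  have hδ : 0 < 2 * (Real.exp (2 * β * ((zdGraph d).neighborFinset 0).card) / 8) /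
      (1 + Real.exp (2 * β * ((zdGraph d).neighborFinset 0).card)) ^ 2 := by positivity
  refine not_isQuasilocalMeasure_decimate_of_gapAt hb0 hδ (fun R => ?_) hμ
  obtain ⟨R', hRR', hgap⟩ := extremalGapAt_alternating hd hb hβ2 hC1 hC2 R
  exact ⟨R', hRR', spacingVolume d b R', zero_mem_spacingVolume b R',
    fun x hx => image_notMem_spacingVolume hb0 R' hx, gapAt_of_extremalGapAt hb0 hβ0 hgap⟩

end Literature.Barriers.CriticalPhenomena.NonGibbs

end
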